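import Summits.ResolutionOfSingularities.ResolutionOfSingularities.Theorems.HomologicalConductorNoZenoStageRational
import HarnessLib

/-!
# Crux `NoZenoR` (stmt-ResolutionOfSingularities-19943) = `NoZeno` (stmt-16483), line `sandwich-cluster`:
# registered stub GE `stub_minResolutionExists` (skeleton v18) — the singular late stage has a
# minimal resolution, modulo the published surface facts

OURS (cell res-hironaka, chain W4.4; stub worker res-L0-w44-stub-3; lead res-L0-w44-lead-1, skeleton
v18 sha16 81aa5a5b746d591c, registry `stub_minResolutionExists`). The registered signature carries the
named facts `CossartJannsenSaito2020General` (unused here), `Lipman1969_1_2`, `Lipman1969_4_1` as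
binders; the proof is `minResolutionExists_of_lipman` (G0a: the singular sandwiched stage has a
rational singularity, `…NoZenoStageRational`; + stub-4's `Lipman1969_4_1.exists_isMinimalResolution_Spec`).
Nothing of [claim: Hironaka2017] is used. AI-written; weaker than expert review.

References: J. Lipman, Publ. Math. IHÉS 36 (1969), Prop. (1.2), Thm. (4.1) [`Lipman1969`].
-/

-- single-problem summit: the doubled namespace component `ResolutionOfSingularities` is forced
set_option linter.dupNamespace false

noncomputable section

namespace Summit.ResolutionOfSingularities.ResolutionOfSingularities.Theorems.NoZeno.SandwichCluster

open CategoryTheory AlgebraicGeometry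
open Literature.AlgebraicGeometry.Resolution
open Summit.ResolutionOfSingularities.ResolutionOfSingularities.Theorems.NoZeno.Birth

/-- **Registered stub GE `stub_minResolutionExists` (skeleton v18), PROVED modulo its named-fact
binders.** For `ctx : SandwichCtx O A R m₀`, `m ≥ m₀ + 1` and the stage `T_m = tower O A m` singular,
`Spec T_m` has a minimal resolution `π : X ⟶ Spec T_m` (`IsMinimalResolution`: a resolution through
which every resolution factors). Proof: `T_m` is a two-dimensional normal Noetherian local domain
with a RATIONAL singularity (`hasRationalSingularity_tower`, Lipman (1.2) (1) on the affine sandwich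
model over the regular `R`), so Lipman's Theorem (4.1) applies to `Spec T_m`
(`Lipman1969_4_1.exists_isMinimalResolution_Spec`). The Cossart–Jannsen–Saito binder is not used.
[cite: Lipman1969, Proposition (1.2) 1) (p. 199) and Theorem (4.1) (p. 204)] -/
theorem stub_minResolutionExists
    (_hCJS : Literature.AlgebraicGeometry.Resolution.CossartJannsenSaito2020General.{0})
    (h12 : Literature.AlgebraicGeometry.Resolution.Lipman1969_1_2.{0})
    (h41 : Literature.AlgebraicGeometry.Resolution.Lipman1969_4_1.{0})
    (p : ℕ) (hp : p.Prime) (k K : Type) [Field k] [CharP k p] [Field K] [Algebra k K]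
    (O : ValuationSubring K) (A R : Subalgebra k K) (m₀ : ℕ) (ctx : SandwichCtx O A R m₀) (m : ℕ)
    (hm : m₀ + 1 ≤ m) (hsing : ¬ IsRegularLocalRing ↥(tower O A m)) :
    ∃ (X : AlgebraicGeometry.Scheme.{0}) (π : X ⟶ AlgebraicGeometry.Spec (CommRingCat.of ↥(tower O A m))),
      Literature.AlgebraicGeometry.Resolution.IsMinimalResolution π :=
  minResolutionExists_of_lipman h12 h41 p hp k K O A R m₀ ctx m hm hsing

end Summit.ResolutionOfSingularities.ResolutionOfSingularities.Theorems.NoZeno.SandwichCluster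

end
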